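import Mathlib
import Summits.Ventures.PercRepro2.Defs
import Summits.Ventures.PercRepro2.Graph
import Summits.Ventures.PercRepro2.ReachClosure

/-!
# Reachability on `Fin n` by bitmask closure: a kernel-cheap decision of `Conn`
(blind cell PercRepro2, mine-1 g49)

`ReachClosure.lean` decides reachability by the iterated neighbourhood closure on `Finset (Fin n)`;
the kernel still pays for every `Finset` operation (quotients, deduplication) and for every `Sym2`
equality inside the adjacency test, at every step of every query.  Here vertex sets are natural
numbers read as bitmasks (`Nat.testBit`), the adjacency of the open graph is computed ONCE into a
table of neighbour masks (`adjB`), and the closure is a fold of `|||` (`stepB`, `closB`).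
`testBit_closB_iff` identifies bit `v` of `closB (adjB G) u k` with `v ∈ Reach.reach G u k`, so
`decConnB` decides the cell's `Conn` through `Reach.reachable_iff_mem_reach` with `n³` word
operations per query.  Definitions (`adjB`, `stepB`, `closB`, `decConnB`), no instances declared,
no notation.
-/

namespace Summit.Ventures.PercRepro2

namespace ReachBits

variable {n : ℕ} (G : SimpleGraph (Fin n)) [DecidableRel G.Adj]

/-- The neighbour mask of `a`: bit `b` is set iff `G.Adj a b`. -/
def adjB (a : Fin n) : ℕ :=
  (List.finRange n).foldl (fun acc (b : Fin n) => if G.Adj a b then acc ||| 2 ^ b.val else acc) 0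

/-- One closure step on masks: add the neighbour masks of every set bit. -/
def stepB (adj : Fin n → ℕ) (m : ℕ) : ℕ :=
  (List.finRange n).foldl (fun acc (a : Fin n) => if m.testBit a.val then acc ||| adj a else acc) m

/-- The closure mask of `u` after `k` steps. -/
def closB (adj : Fin n → ℕ) (u : Fin n) : ℕ → ℕ
  | 0 => 2 ^ (u : ℕ)
  | k + 1 => stepB adj (closB adj u k)

/-- Bits of a fold of `|||` over a list: set iff set in the start or in one of the added masks. -/
lemma testBit_foldl_lor {α : Type*} (l : List α) (f : α → ℕ) (P : α → Prop) [DecidablePred P]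
    (m : ℕ) (v : ℕ) :
    (l.foldl (fun acc a => if P a then acc ||| f a else acc) m).testBit v =
      (m.testBit v || l.any (fun a => decide (P a) && (f a).testBit v)) := by
  induction l generalizing m with
  | nil => simp
  | cons a l ih =>
    simp only [List.foldl_cons, List.any_cons]
    rw [ih]
    by_cases h : P a
    · simp [h, Bool.or_assoc]
    · simp [h]

/-- Bit `b` of the neighbour mask of `a` is adjacency. -/
lemma testBit_adjB (a b : Fin n) : (adjB G a).testBit b = decide (G.Adj a b) := by
  unfold adjB
  rw [testBit_foldl_lor]
  simp only [Nat.zero_testBit, Bool.false_or, Nat.testBit_two_pow]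
  apply Bool.eq_iff_iff.mpr
  simp only [List.any_eq_true, List.mem_finRange, true_and, Bool.and_eq_true, decide_eq_true_eq]
  constructor
  · rintro ⟨c, hc, hcb⟩
    exact (Fin.ext hcb) ▸ hc
  · intro h
    exact ⟨b, h, rfl⟩

/-- Bit `v` after a step: set before, or a neighbour of a set bit. -/
lemma testBit_stepB (adj : Fin n → ℕ) (m : ℕ) (v : Fin n) :
    (stepB adj m).testBit v = (m.testBit v || (List.finRange n).any
      (fun a : Fin n => decide (m.testBit a.val = true) && (adj a).testBit v)) := by
  unfold stepB
  rw [testBit_foldl_lor]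

/-- **Bit `v` of the closure mask is membership in the neighbourhood closure.** -/
theorem testBit_closB_iff (u v : Fin n) : ∀ k,
    (closB (adjB G) u k).testBit v = true ↔ v ∈ Reach.reach G u k
  | 0 => by
      simp only [closB, Reach.reach, Finset.mem_singleton, Nat.testBit_two_pow, decide_eq_true_eq]
      exact ⟨fun h => (Fin.ext h).symm, fun h => congrArg Fin.val h.symm⟩
  | k + 1 => by
      simp only [closB, Reach.reach, Reach.step, Finset.mem_union, Finset.mem_filter,
        Finset.mem_univ, true_and]
      rw [testBit_stepB, Bool.or_eq_true, List.any_eq_true]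
      simp only [List.mem_finRange, true_and, Bool.and_eq_true, decide_eq_true_eq, testBit_adjB]
      constructor
      · rintro (h | ⟨a, ha, hav⟩)
        · exact Or.inl ((testBit_closB_iff u v k).1 h)
        · exact Or.inr ⟨a, (testBit_closB_iff u a k).1 ha, hav⟩
      · rintro (h | ⟨a, ha, hav⟩)
        · exact Or.inl ((testBit_closB_iff u v k).2 h)
        · exact Or.inr ⟨a, (testBit_closB_iff u a k).2 ha, hav⟩

end ReachBits

section DecConnB

variable {n : ℕ} {E : Type*} [Fintype E]

/-- The bitmask decision of `Conn` on `Fin n` (a `def`; install it locally where needed). -/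
def decConnB (ends : E → Sym2 (Fin n)) (ω : Config E) (u v : Fin n) : Decidable (Conn ends ω u v) :=
  decidable_of_iff ((ReachBits.closB (ReachBits.adjB (openGraph ends ω)) u n).testBit v = true)
    (by
      have h := Reach.reachable_iff_mem_reach (openGraph ends ω) u v
      rw [Fintype.card_fin] at h
      rw [ReachBits.testBit_closB_iff]
      exact h.symm)

end DecConnB

end Summit.Ventures.PercRepro2
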